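import Mathlib
import Summits.CriticalPhenomena.PercolationContinuityZ3.Theorems.PercNearOneGluingNoHeavyLowerTailPocketDeletionGluing
import Literature.Probability.Percolation.KozmaNitzanGoodQuadruple
import HarnessLib

/-!
# `NoHeavyLowerTail` (stmt-CriticalPhenomena-4575) — Kozma–Nitzan's Conjecture 3 holds for every
# DEPTH-TWO (pendant-star) observer, unconditionally and uniformly: `μ(o ↮ b) ≤ μ(o ↮ A) + √t`

Support file (depth prover `nh-dp-blobmono`, respawn g5; `--supports stmt-CriticalPhenomena-4575`).  No definitions,
no named facts, no sorries.

Finite weighted graph on `Fin n` (weights `w`, `μ = prodBernoulli w`), relay set `A`, target `b ∈ A`, observer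
`o ∉ A`.  The observer is DEPTH-TWO (a "pendant-star observer", lead memo LEAD-GEN5 §4b MODEL CLASS): every
non-relay vertex `x` with `w s(o,x) ≠ 0` has all its other positive-weight pairs ending in `A` (so the
non-relay neighbours of `o` are pendant Steiner stars, pairwise non-adjacent, attached only to `o` and to
relays); `o` may also have direct relay edges; the relay side of the graph is arbitrary; the number of stars
and `|A|` are arbitrary.

* `observerBridge` (ANY graph, any `o, a, b`): **`μ(o ↮ b) · μ_{G−o}(a ↮ b) ≤ μ(a ↮ b)`**, where `μ_{G−o}` is the
  law with every pair at `o` given weight `0`.  (Harris for the two decreasing events `{o ↮ b}` and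
  `{a ↮ b off o}`, whose intersection forces `a ↮ b`.)  So a relay that is `t`-reliable to `b` in `G` but
  `θ`-unreliable in `G − o` certifies `μ(o ↮ b) ≤ t/θ`: either all relays are reliable WITHOUT `o`, or `o` is
  itself well connected to `b`.  Consequently Kozma–Nitzan's Conjecture 3 is EQUIVALENT to its version with
  the relay hypothesis measured in `G − o` (`δ ↦ √δ`).
* `pendantStarGluing_block`, `pendantStarGluing` — ADDITIVE GLUING IN `H`-FORM for depth-two observers:
  **`μ(o ↔ A) − μ(o ↔ b) ≤ max_{a∈A} μ_{G−o}(a ↮ b)`** (stated with a slack `θ`).  Proof = the block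
  σ-recursion of `…PocketDeletionGluing.lean` (`blockLayerDecomposition`) with a different base: a positive
  layer `S` of `o` avoiding `A` is a set of pendant stars, hence STAR-ATTACHED under the `o`-deleted weights,
  and `pocketGlue_base` (= `blockStarGluing`, Kozma–Nitzan Thm 4 in block form) bounds its defect by the relay
  unreliability in the glued graph, which is at most that of `G − o` (monotone coupling).  This is the lead's
  "PAPER THEOREM" of LEAD-GEN5 §4b (there sketched via Lemma 5 + goodness + a switch defect), r- and k-uniform.
* `pendantStar_nearOneGluing` — **`μ(o ↮ b) ≤ μ(o ↮ A) + √t`** whenever `μ(a ↮ b) ≤ t` for all `a ∈ A`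
  (`b ∈ A`): combine the two displays at the relay `a*` maximising `μ_{G−o}(a ↮ b) =: θ*`:
  `μ(o ↮ b) ≤ min(μ(o ↮ A) + θ*, t/θ*) ≤ μ(o ↮ A) + √t`.  Equivalently (`pendantStar_relayTargetGluing`)
  the relay-target event gluing `μ(o ↔ A, o ↮ b) ≤ √t` for every relay `b`.
  This is `NearOneGluing` = KN Conjecture 3 (arXiv:2401.12397 p.15) ON THE CLASS OF DEPTH-TWO OBSERVERS with
  `δ(ε) = min(ε/2, ε²/4)`, uniformly in the number of stars, in `|A|` and in the graph; previously available:
  one star (KN Thm 5, linear), `m` stars with rate `t^{1/(m+1)}` (`pocketSizeGluing`), all depth-two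
  observers but with reliability measured in `G − o` (LEAD-GEN5 §4b / hp-6 conditional), relays reliable
  through relays only (`nearOneGluing_of_relayCore`).  Answers LEAD-GEN5 HANDOFF (Q5) up to the square root.
-/

namespace Summit.CriticalPhenomena.PercolationContinuityZ3.Theorems

open MeasureTheory Set
open Literature.Probability.LatticeModels (prodBernoulli prodBernoulli_real_mono_of_isUpperSet
  prodBernoulli_harris_lower)
open Literature.Probability.Percolation (BondConfig openConn openConnIn openGraph isUpperSet_openConn
  isUpperSet_openConnIn restrW wireSet)

noncomputable section
open Classical

variable {n : ℕ}

/-! ### 1. The observer bridge (valid on every finite weighted graph) -/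

/-- If `a ↔ b` but `o ↮ b` then `a ↔ b` off `o`. [folklore] -/
theorem openConn_diff_subset_openConnIn (o a b : Fin n) :
    (openConn a b : Set (BondConfig (Fin n))) ∩ (openConn o b)ᶜ ⊆ openConnIn (({o} : Set (Fin n))ᶜ) a b := by
  rintro ω ⟨hab, hob⟩
  refine Literature.Probability.Percolation.KNGoodAux.openConnIn_of_reachable_of_forall_mem hab ?_
  intro y hay hyo
  rw [Set.mem_singleton_iff] at hyo
  subst hyo
  exact hob (hay.symm.trans hab)

/-- The `o`-deleted weights dominate the restriction to `{o}ᶜ` (they differ only on the irrelevant diagonal),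
so `μ_{G−o}(a ↮ b) ≤ μ(a ↮ b off o)`. [folklore] -/
theorem kill_singleton_compl_le_openConnIn (w : Sym2 (Fin n) → unitInterval) (o a b : Fin n) (hao : a ≠ o) :
    (prodBernoulli (fun e : Sym2 (Fin n) => if (∃ x ∈ e, x ∈ ({o} : Finset (Fin n))) then 0 else w e)).real
        (openConn a b)ᶜ ≤
      (prodBernoulli w).real (openConnIn (({o} : Set (Fin n))ᶜ) a b)ᶜ := by
  have hle : restrW (({o} : Set (Fin n))ᶜ) w ≤
      (fun e : Sym2 (Fin n) => if (∃ x ∈ e, x ∈ ({o} : Finset (Fin n))) then 0 else w e) := by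
    intro e
    show restrW (({o} : Set (Fin n))ᶜ) w e ≤
      (if (∃ x ∈ e, x ∈ ({o} : Finset (Fin n))) then (0 : unitInterval) else w e)
    by_cases h : ∃ x ∈ e, x ∈ ({o} : Finset (Fin n))
    · rw [if_pos h]
      have hnot : e ∉ wireSet (({o} : Set (Fin n))ᶜ) := by
        obtain ⟨x, hx, hxo⟩ := h
        rw [Finset.mem_singleton] at hxo
        intro hw
        exact (hw.1 x hx) (by simp [hxo])
      rw [Literature.Probability.Percolation.restrW_apply_of_not_mem w hnot]
    · rw [if_neg h]
      by_cases hw : e ∈ wireSet (({o} : Set (Fin n))ᶜ)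
      · rw [Literature.Probability.Percolation.restrW_apply_of_mem w hw]
      · rw [Literature.Probability.Percolation.restrW_apply_of_not_mem w hw]
        exact unitInterval.nonneg'
  have hmono := prodBernoulli_real_mono_of_isUpperSet hle (isUpperSet_openConn a b) (pocketGlue_measurableSet _)
  have hr := Literature.Probability.Percolation.KNGoodAux.restrW_real_openConn w o hao b
  rw [probReal_compl_eq_one_sub (pocketGlue_measurableSet _),
    probReal_compl_eq_one_sub (pocketGlue_measurableSet _)]
  linarith

/-- **Observer bridge.**  For every finite weighted graph and all vertices `o, a, b` with `a ≠ o`: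
`μ(o ↮ b) · μ_{G−o}(a ↮ b) ≤ μ(a ↮ b)`, `μ_{G−o}` = the law with the pairs at `o` given weight `0`.
Harris for the decreasing events `{o ↮ b}`, `{a ↮ b off o}`, and `{o ↮ b} ∩ {a ↮ b off o} ⊆ {a ↮ b}`.
[this work; cite: Grimmett1999, Thm. (2.4) p. 34 (Harris)] -/
theorem observerBridge (w : Sym2 (Fin n) → unitInterval) (o a b : Fin n) (hao : a ≠ o) :
    (prodBernoulli w).real (openConn o b)ᶜ *
        (prodBernoulli (fun e : Sym2 (Fin n) => if (∃ x ∈ e, x ∈ ({o} : Finset (Fin n))) then 0 else w e)).real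
          (openConn a b)ᶜ ≤
      (prodBernoulli w).real (openConn a b)ᶜ := by
  have h1 := kill_singleton_compl_le_openConnIn w o a b hao
  have hlowo : IsLowerSet ((openConn o b : Set (BondConfig (Fin n)))ᶜ) := (isUpperSet_openConn o b).compl
  have hlowa : IsLowerSet ((openConnIn (({o} : Set (Fin n))ᶜ) a b : Set (BondConfig (Fin n)))ᶜ) :=
    (isUpperSet_openConnIn _ a b).compl
  have hH := prodBernoulli_harris_lower w hlowo hlowa (pocketGlue_measurableSet _) (pocketGlue_measurableSet _)
  have hsub : (openConn o b : Set (BondConfig (Fin n)))ᶜ ∩ (openConnIn (({o} : Set (Fin n))ᶜ) a b)ᶜ ⊆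
      (openConn a b)ᶜ := by
    intro ω hω hab
    exact hω.2 (openConn_diff_subset_openConnIn o a b ⟨hab, hω.1⟩)
  have hm := measureReal_mono hsub (measure_ne_top (prodBernoulli w) _)
  calc (prodBernoulli w).real (openConn o b)ᶜ *
        (prodBernoulli (fun e : Sym2 (Fin n) => if (∃ x ∈ e, x ∈ ({o} : Finset (Fin n))) then 0 else w e)).real
          (openConn a b)ᶜ
      ≤ (prodBernoulli w).real (openConn o b)ᶜ *
          (prodBernoulli w).real (openConnIn (({o} : Set (Fin n))ᶜ) a b)ᶜ :=
        mul_le_mul_of_nonneg_left h1 measureReal_nonneg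
    _ ≤ (prodBernoulli w).real ((openConn o b)ᶜ ∩ (openConnIn (({o} : Set (Fin n))ᶜ) a b)ᶜ) := hH
    _ ≤ (prodBernoulli w).real (openConn a b)ᶜ := hm

/-! ### 2. Additive gluing in `H`-form for pendant-star (depth-two) observer blocks -/

/-- **Pendant-star gluing, block form.**  Contracted block `O` (`glue w O`), relays `A ∋ b` disjoint from
`O`, and the PENDANT condition: every non-relay `x ∉ O` with a positive-weight pair to `O` has all its other
positive-weight pairs ending in `O ∪ A`.  If every relay has `μ_{kill w O}(a ↮ b) ≤ θ` (unreliability with the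
block DELETED) then `μ(O ↔ A) − μ(O ↔ b) ≤ θ`. [this work; cite: KozmaNitzan2024, Thm. 4 (p. 12)] -/
theorem pendantStarGluing_block (w : Sym2 (Fin n) → unitInterval) (O A : Finset (Fin n)) (b : Fin n) (θ : ℝ)
    (hbA : b ∈ A) (hOA : Disjoint O A)
    (hpend : ∀ x : Fin n, x ∉ O → x ∉ A → (∃ o ∈ O, w s(o, x) ≠ 0) →
      ∀ y : Fin n, y ∉ O → y ∉ A → y ≠ x → w s(x, y) = 0)
    (hrel : ∀ a ∈ A, (prodBernoulli (fun e : Sym2 (Fin n) =>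
      if (∃ x ∈ e, x ∈ O) then 0 else w e)).real (openConn a b)ᶜ ≤ θ) :
    (prodBernoulli (fun e : Sym2 (Fin n) => if (∀ x ∈ e, x ∈ O) ∧ ¬ e.IsDiag then 1 else w e)).real
        (⋃ o ∈ O, ⋃ x ∈ A, openConn o x) -
      (prodBernoulli (fun e : Sym2 (Fin n) => if (∀ x ∈ e, x ∈ O) ∧ ¬ e.IsDiag then 1 else w e)).real
        (⋃ o ∈ O, openConn o b) ≤ θ := by
  have hbO : b ∉ O := fun h => Finset.disjoint_left.1 hOA h hbA
  have hθ0 : 0 ≤ θ := by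
    have h := hrel b hbA
    have huniv : (openConn b b : Set (BondConfig (Fin n))) = Set.univ :=
      Set.eq_univ_of_forall fun _ => SimpleGraph.Reachable.refl _
    rw [huniv, Set.compl_univ, measureReal_empty] at h
    exact h
  set g : Sym2 (Fin n) → unitInterval :=
    fun e => if (∀ x ∈ e, x ∈ O) ∧ ¬ e.IsDiag then 1 else w e with hg
  set k : Sym2 (Fin n) → unitInterval := fun e => if (∃ x ∈ e, x ∈ O) then 0 else w e with hk
  set q : Finset (Fin n) → Sym2 (Fin n) → unitInterval := fun S e =>
    if (∀ x ∈ e, x ∈ S) ∧ ¬ e.IsDiag then 1 else if (∃ x ∈ e, x ∈ O) then 0 else w e with hq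
  set ℓ : Finset (Fin n) → ℝ := fun S => (prodBernoulli g).real
    {ω : BondConfig (Fin n) | ∀ x : Fin n, x ∈ S ↔ (x ∉ O ∧ ∃ o ∈ O, s(o, x) ∈ ω)} with hℓ
  set α : Finset (Fin n) → ℝ := fun S => (prodBernoulli (q S)).real
    (⋃ s ∈ S, ⋃ x ∈ A, openConn s x) with hα
  set β : Finset (Fin n) → ℝ := fun S => (prodBernoulli (q S)).real (⋃ s ∈ S, openConn s b) with hβ
  obtain ⟨hone, hpos, hAsum, hbsum, -⟩ := blockLayerDecomposition n w O A b b hOA hbO hbO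
  change ∑ S : Finset (Fin n), ℓ S = 1 at hone
  change ∀ S : Finset (Fin n), ℓ S ≠ 0 → ∀ x ∈ S, x ∉ O ∧ ∃ o ∈ O, w s(o, x) ≠ 0 at hpos
  change (prodBernoulli g).real (⋃ o ∈ O, ⋃ x ∈ A, openConn o x) =
    ∑ S : Finset (Fin n), ℓ S * α S at hAsum
  change (prodBernoulli g).real (⋃ o ∈ O, openConn o b) = ∑ S : Finset (Fin n), ℓ S * β S at hbsum
  -- sub-blocks: unreliability in the glued sub-instance is at most the block-deleted deadness, hence `≤ θ`
  have hsub : ∀ (S : Finset (Fin n)) (a : Fin n), a ∈ A →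
      (prodBernoulli (q S)).real (openConn a b)ᶜ ≤ θ := by
    intro S a ha
    calc (prodBernoulli (q S)).real (openConn a b)ᶜ ≤ (prodBernoulli k).real (openConn a b)ᶜ :=
          pocketGlue_compl_mono w O S a b
      _ ≤ θ := hrel a ha
  -- termwise bound `bad'_S ≤ θ`
  have hterm : ∀ S : Finset (Fin n), ℓ S ≠ 0 → α S - β S ≤ θ := by
    intro S hS0
    have hS := hpos S hS0
    have hα1 : α S ≤ 1 := measureReal_le_one
    by_cases hSA : (S ∩ A).Nonempty
    · obtain ⟨v, hv⟩ := hSA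
      rw [Finset.mem_inter] at hv
      have hvb : 1 - β S ≤ (prodBernoulli (q S)).real (openConn v b)ᶜ := by
        rw [probReal_compl_eq_one_sub (pocketGlue_measurableSet _)]
        have : (prodBernoulli (q S)).real (openConn v b) ≤ β S :=
          measureReal_mono (fun ω hω => Set.mem_iUnion₂.2 ⟨v, hv.1, hω⟩) (measure_ne_top _ _)
        linarith
      linarith [hsub S v hv.2]
    · have hSA' : Disjoint S A :=
        Finset.disjoint_iff_inter_eq_empty.2 (Finset.not_nonempty_iff_eq_empty.1 hSA)
      by_cases hSe : S = ∅
      · subst hSe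
        have hα0 : α ∅ = 0 := by simp [hα]
        have hβ0 : β ∅ = 0 := by simp [hβ]
        rw [hα0, hβ0, sub_zero]
        exact hθ0
      · -- a non-empty positive layer avoiding `A` is a set of pendant stars: star-attached under `k`
        have hstar : ∀ x ∈ S, ∀ y : Fin n, y ∉ S → y ∉ A → k s(x, y) = 0 := by
          intro x hxS y hyS hyA
          obtain ⟨hxO, hox⟩ := hS x hxS
          have hxA : x ∉ A := fun h => Finset.disjoint_left.1 hSA' hxS h
          simp only [hk]
          split_ifs with hxy
          · rfl
          · push Not at hxy
            have hyO : y ∉ O := fun h => hxy y (Sym2.mem_mk_right x y) h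
            have hyx : y ≠ x := fun h => hyS (h ▸ hxS)
            exact hpend x hxO hxA hox y hyO hyA hyx
        have hrelS : ∀ a ∈ A, (prodBernoulli (fun e : Sym2 (Fin n) =>
            if (∀ x ∈ e, x ∈ S) ∧ ¬ e.IsDiag then 1 else k e)).real (openConn a b)ᶜ ≤ θ := by
          intro a ha
          exact hsub S a ha
        have key := pocketGlue_base k S A b θ hbA hSA' hstar hrelS
        exact key
  rw [hAsum, hbsum, ← Finset.sum_sub_distrib]
  have heq : ∑ S : Finset (Fin n), (ℓ S * α S - ℓ S * β S) = ∑ S : Finset (Fin n), ℓ S * (α S - β S) :=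
    Finset.sum_congr rfl fun S _ => by ring
  rw [heq]
  exact pocketGlue_convex_le Finset.univ ℓ (fun S => α S - β S) θ (fun S _ => measureReal_nonneg) hone
    fun S _ hS => hterm S hS

/-- **Pendant-star gluing** (`H`-form, vertex version).  Observer `o ∉ A`, relays `A ∋ b`, and the
DEPTH-TWO condition: every non-relay `x ≠ o` with `w s(o,x) ≠ 0` has all its other positive-weight pairs
ending in `A` (pendant Steiner stars; `o` may also have direct relay edges).  If `μ_{G−o}(a ↮ b) ≤ θ` for every
`a ∈ A` then `μ(o ↔ A) − μ(o ↔ b) ≤ θ`: additive gluing with the relays' unreliability measured WITHOUT the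
observer, uniformly in the number of stars and in `|A|` (LEAD-GEN5 §4b "paper theorem").
[this work; cite: KozmaNitzan2024, Thms. 4–5 (pp. 12–13)] -/
theorem pendantStarGluing (w : Sym2 (Fin n) → unitInterval) (A : Finset (Fin n)) (o b : Fin n) (θ : ℝ)
    (hbA : b ∈ A) (hoA : o ∉ A)
    (hpend : ∀ x : Fin n, x ≠ o → x ∉ A → w s(o, x) ≠ 0 →
      ∀ y : Fin n, y ≠ o → y ∉ A → y ≠ x → w s(x, y) = 0)
    (hrel : ∀ a ∈ A, (prodBernoulli (fun e : Sym2 (Fin n) =>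
      if (∃ x ∈ e, x ∈ ({o} : Finset (Fin n))) then 0 else w e)).real (openConn a b)ᶜ ≤ θ) :
    (prodBernoulli w).real (⋃ a ∈ A, openConn o a) - (prodBernoulli w).real (openConn o b) ≤ θ := by
  have hOA : Disjoint ({o} : Finset (Fin n)) A := Finset.disjoint_singleton_left.2 hoA
  have hpend' : ∀ x : Fin n, x ∉ ({o} : Finset (Fin n)) → x ∉ A →
      (∃ o' ∈ ({o} : Finset (Fin n)), w s(o', x) ≠ 0) →
      ∀ y : Fin n, y ∉ ({o} : Finset (Fin n)) → y ∉ A → y ≠ x → w s(x, y) = 0 := by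
    intro x hxo hxA hex y hyo hyA hyx
    rw [Finset.mem_singleton] at hxo hyo
    obtain ⟨o', ho', hw⟩ := hex
    rw [Finset.mem_singleton] at ho'
    subst ho'
    exact hpend x hxo hxA hw y hyo hyA hyx
  have key := pendantStarGluing_block w {o} A b θ hbA hOA hpend' hrel
  rw [agPartial_glue_singleton, Finset.set_biUnion_singleton, Finset.set_biUnion_singleton] at key
  exact key

/-! ### 3. The combination: Conjecture 3 on the depth-two class with modulus `√t` -/

/-- Real arithmetic of the dichotomy: `X ≤ d + θ` and `X·θ ≤ t` (`d, t ≥ 0`) give `X ≤ d + √t`. [folklore] -/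
theorem le_add_sqrt_of_dichotomy {X d θ t : ℝ} (hd : 0 ≤ d) (ht : 0 ≤ t)
    (h1 : X ≤ d + θ) (h2 : X * θ ≤ t) : X ≤ d + Real.sqrt t := by
  by_cases hθt : θ ≤ Real.sqrt t
  · linarith
  · push Not at hθt
    have hst : 0 ≤ Real.sqrt t := Real.sqrt_nonneg t
    have hθpos : 0 < θ := lt_of_le_of_lt hst hθt
    have hXs : X ≤ Real.sqrt t := by
      by_contra hc
      push Not at hc
      have h3 : Real.sqrt t * Real.sqrt t < X * θ := by
        calc Real.sqrt t * Real.sqrt t ≤ Real.sqrt t * θ := mul_le_mul_of_nonneg_left hθt.le hst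
          _ < X * θ := mul_lt_mul_of_pos_right hc hθpos
      rw [Real.mul_self_sqrt ht] at h3
      linarith
    linarith

/-- **Kozma–Nitzan's Conjecture 3 for depth-two observers, modulus `√t`.**  For a depth-two (pendant-star)
observer `o ∉ A`, a relay `b ∈ A` and `t` with `μ(a ↮ b) ≤ t` for all `a ∈ A`:
**`μ(o ↮ b) ≤ μ(o ↮ A) + √t`**, uniformly in the number of stars, in `|A|` and in the graph.
Proof: `pendantStarGluing` with `θ* = max_a μ_{G−o}(a ↮ b)` and `observerBridge` at the maximiser give
`μ(o ↮ b) ≤ min(μ(o ↮ A) + θ*, t/θ*)`. [this work; cite: KozmaNitzan2024, Conjecture 3 (p. 15)] -/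
theorem pendantStar_nearOneGluing (w : Sym2 (Fin n) → unitInterval) (A : Finset (Fin n)) (o b : Fin n) (t : ℝ)
    (hbA : b ∈ A) (hoA : o ∉ A)
    (hpend : ∀ x : Fin n, x ≠ o → x ∉ A → w s(o, x) ≠ 0 →
      ∀ y : Fin n, y ≠ o → y ∉ A → y ≠ x → w s(x, y) = 0)
    (hrel : ∀ a ∈ A, (prodBernoulli w).real (openConn a b)ᶜ ≤ t) :
    (prodBernoulli w).real (openConn o b)ᶜ ≤
      (prodBernoulli w).real (⋃ a ∈ A, openConn o a)ᶜ + Real.sqrt t := by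
  set μ := prodBernoulli w with hμ
  set kw : Sym2 (Fin n) → unitInterval :=
    fun e => if (∃ x ∈ e, x ∈ ({o} : Finset (Fin n))) then 0 else w e with hkw
  have hAne : A.Nonempty := ⟨b, hbA⟩
  -- the worst relay without `o`
  obtain ⟨aStar, haStar, hmax⟩ := Finset.exists_max_image A
    (fun a => (prodBernoulli kw).real (openConn a b)ᶜ) hAne
  set θ : ℝ := (prodBernoulli kw).real (openConn aStar b)ᶜ with hθ
  have ht0 : 0 ≤ t := le_trans measureReal_nonneg (hrel b hbA)
  -- (i) H-form gluing
  have hglue := pendantStarGluing w A o b θ hbA hoA hpend (fun a ha => hmax a ha)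
  -- (ii) the bridge at `aStar`
  have haStaro : aStar ≠ o := fun h => hoA (h ▸ haStar)
  have hbridge := observerBridge w o aStar b haStaro
  have hbr : μ.real (openConn o b)ᶜ * θ ≤ t := le_trans hbridge (hrel aStar haStar)
  -- (iii) combine
  have hcA : μ.real (⋃ a ∈ A, openConn o a)ᶜ = 1 - μ.real (⋃ a ∈ A, openConn o a) :=
    probReal_compl_eq_one_sub (pocketGlue_measurableSet _)
  have hcb : μ.real (openConn o b)ᶜ = 1 - μ.real (openConn o b) :=
    probReal_compl_eq_one_sub (pocketGlue_measurableSet _)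
  have h1 : μ.real (openConn o b)ᶜ ≤ μ.real (⋃ a ∈ A, openConn o a)ᶜ + θ := by
    rw [hcA, hcb]; linarith
  exact le_add_sqrt_of_dichotomy measureReal_nonneg ht0 h1 hbr

/-- **Relay-target event gluing for depth-two observers**: `μ(o ↔ A, o ↮ b) ≤ √t` for every relay `b ∈ A`
(same hypotheses).  This is the class form of the crux's relay-target socket
(`Theorems.noHeavyLowerTail_of_relayTargetGluing`). [this work] -/
theorem pendantStar_relayTargetGluing (w : Sym2 (Fin n) → unitInterval) (A : Finset (Fin n)) (o b : Fin n)
    (t : ℝ) (hbA : b ∈ A) (hoA : o ∉ A)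
    (hpend : ∀ x : Fin n, x ≠ o → x ∉ A → w s(o, x) ≠ 0 →
      ∀ y : Fin n, y ≠ o → y ∉ A → y ≠ x → w s(x, y) = 0)
    (hrel : ∀ a ∈ A, (prodBernoulli w).real (openConn a b)ᶜ ≤ t) :
    (prodBernoulli w).real ((⋃ a ∈ A, openConn o a) ∩ (openConn o b)ᶜ) ≤ Real.sqrt t := by
  set μ := prodBernoulli w with hμ
  have h := pendantStar_nearOneGluing w A o b t hbA hoA hpend hrel
  have hsub : (openConn o b : Set (BondConfig (Fin n))) ⊆ ⋃ a ∈ A, openConn o a :=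
    fun ω hω => Set.mem_iUnion₂.2 ⟨b, hbA, hω⟩
  -- `μ(U ∩ Bᶜ) = μ(U) − μ(B)` for `B ⊆ U`
  have hdiff : μ.real ((⋃ a ∈ A, openConn o a) ∩ (openConn o b)ᶜ) =
      μ.real (⋃ a ∈ A, openConn o a) - μ.real (openConn o b) := by
    rw [← Set.sdiff_eq]
    exact measureReal_sdiff hsub (pocketGlue_measurableSet _) (measure_ne_top _ _)
  have hcA : μ.real (⋃ a ∈ A, openConn o a)ᶜ = 1 - μ.real (⋃ a ∈ A, openConn o a) :=
    probReal_compl_eq_one_sub (pocketGlue_measurableSet _)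
  have hcb : μ.real (openConn o b)ᶜ = 1 - μ.real (openConn o b) :=
    probReal_compl_eq_one_sub (pocketGlue_measurableSet _)
  rw [hdiff]
  rw [hcA, hcb] at h
  linarith

end

end Summit.CriticalPhenomena.PercolationContinuityZ3.Theorems
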